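import Summits.BirchSwinnertonDyer.Rank1Residual.X2.RankOneRegulator
import HarnessLib

/-!
# Class X2, sub-cell X2c (rank one), λ-minimal pairs: `BSD(E,p) ⟺ ONE p-adic regulator valuation`
# (cell `b2b-bsdres`, unit `b2b-bsdres-eisenstein-p2`, gen 5; companion of `X2/RankOneRegulator.lean`)

HONEST FRAMING (run/shared/lean/b2b/bsd-rank1-residual/, verbatim in every file): the goal of the
cell is to DELETE the COMBINATION-SHAPED residual classes of the Birch–Swinnerton-Dyer formula for
ALL analytic-rank `≤ 1` elliptic curves over `ℚ` — "full BSD formula for every rank `≤ 1` curve in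
class `C`" assembled STRICTLY from published theorems — so that the rank-`≤ 1` remainder becomes
exactly the CONSTRUCTION-SHAPED classes, which are TYPED (missing-input `Prop`s), NOT attempted.
This is not "finishing BSD". Research route; NO CLAIM BEYOND STATED CLASSES; nothing here changes
a label; X2c stays CONSTRUCTION-SHAPED. Theorems only (no definition, no named fact).

WHAT. `X2/RankOneRegulator.lean` proves, at an X2c pair with `(μ_an, λ_an) = (0, 1 + e)`, the exact
identity `ord_p #Ш(E/ℚ)[p^∞] + e·ord_p 𝓛_p + ord_p Reg_p(E,Dh) + ord_p ∏c_ℓ = 1 + e + 2·ord_p #E(ℚ)_tors`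
for THE Stein–Wuthrich §4.2 height `Dh` (`e = 1` split / `0` non-split). With Miller's `BSD(E,p)`
(Def. 1.1: `rank = r_an`, `Ш[p^∞]` finite, `ord_p #Ш_an = ord_p #Ш[p^∞]`; the first two hold here by
Gross–Zagier–Kolyvagin) and the pair's rational `#Ш_an = s` this gives

* `bsdp_iff_regulatorValuation_of_lamMin_{split,nonsplit}`:
  **`BSD(E,p) ⟺ ord_p Reg_p(E,Dh) = 1 + e + 2·ord_p #tors − e·ord_p 𝓛_p − ord_p ∏c_ℓ − ord_p s`**;
* the certificate direction `bsdp_of_lamMin_of_regulatorValuation_{split,nonsplit}` and the sub-cell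
  form `cellC_bsdp_of_lamMin_of_regulatorValuation` (height datum quantified under its pinning
  predicate; existence `exists_is{Split,}MultCanonical`): lever L3
  (`Typed.X2.bsdp_of_thm16mult_*_of_canonical_certificate`, PUB inputs + `hordL` + `hcert` +
  `p ∤ #Ш_an`) with the `p`-adic `L`-series data REPLACED by the already-certified λ-minimality bits
  and WITHOUT the hypothesis `p ∤ #Ш_an` — ONE valuation of ONE height is the whole certificate, and
  by the `iff` it is also NECESSARY (a computed `ord_p Reg_p` off the predicted value refutes
  `BSD(E,p)` at the pair; none expected: `#Ш_an = 1` on all 705 X2c census pairs, N < 2·10⁴).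

Per pair; booking needs the two-engine `(μ_an, λ_an)` table (R93.3) and a two-engine `ord_p Reg_p`.

References: [SteinWuthrich2013] Thm. 6.1 (p. 20), §4.2; [Wuthrich2014] Thm. 16; [Miller2011LMS]
Def. 1.1; HOME/b2b-bsdres-eisenstein-p2/X2-GAP.md §10.
-/

set_option autoImplicit false

noncomputable section

open scoped Classical MatrixGroups ModularForm

open PowerSeries CongruenceSubgroup WeierstrassCurve Literature.NumberTheory.EllipticCurves
  Literature.NumberTheory.EllipticCurves.ModularForms
  Literature.NumberTheory.EllipticCurves.Rank1Residual
  Literature.NumberTheory.EllipticCurves.Rank1Residual.Typed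
  Literature.NumberTheory.EllipticCurves.Wuthrich2014
  Literature.NumberTheory.EllipticCurves.SteinWuthrich2013

namespace Summit.BirchSwinnertonDyer.Rank1Residual.X2

/-! ## `BSD(E,p)` at a λ-minimal X2c pair ⟺ one regulator valuation -/

section BSDp

variable {W : WeierstrassCurve ℚ} [W.IsElliptic] [W.IsGloballyMinimal] {p : ℕ} [Fact p.Prime]

/-- Miller's `BSD(E,p)` with the analytic order of `Ш` pinned to a rational `s`: granted
`rank E(ℚ) = r_an` and `Ш(E/ℚ)[p^∞]` finite, `BSD(E,p) ⟺ ord_p s = ord_p #Ш(E/ℚ)[p^∞]` (the witness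
in `BSDp` is unique, `ℚ → ℂ` being injective). [cite: Miller2011LMS, Def. 1.1 (arXiv:1010.2431 p. 3)] -/
theorem bsdp_iff_padicValRat_eq_of_shaAn_eq (W : WeierstrassCurve ℚ) [W.IsElliptic] (p : ℕ)
    [Fact p.Prime] (hrank : W.mordellWeilRank = W.analyticRank)
    (hfin : Finite (AddCommGroup.primaryComponent W.sha p)) {s : ℚ} (hs : shaAn W = (s : ℂ)) :
    BSDp W p ↔
      padicValRat p s = padicValNat p (Nat.card (AddCommGroup.primaryComponent W.sha p)) := by
  constructor
  · rintro ⟨-, -, q, hq, hv⟩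
    have hqs : q = s := by
      have e : ((q : ℚ) : ℂ) = ((s : ℚ) : ℂ) := hq.symm.trans hs
      exact_mod_cast e
    rw [← hqs]; exact hv
  · intro hv
    exact ⟨hrank, hfin, s, hs, hv⟩

/-- **SPLIT `p`, λ-minimal X2c pair: `BSD(E,p) ⟺ ord_p Reg_p(E,Dh) = 2 + 2·ord_p #tors − ord_p 𝓛_p −
ord_p ∏c_ℓ − ord_p #Ш_an`.** Hypotheses as in `schneider_and_shaIdentity_of_lamMin_split`, plus the
pair's rational analytic order of `Ш` (`hs : shaAn W = s`). The regulator valuation is a NECESSARY AND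
SUFFICIENT certificate. [cite: SteinWuthrich2013, Thm. 6.1 (p. 20) and §4.2] [cite: Wuthrich2014, Thm. 16]
[cite: Miller2011LMS, Def. 1.1] -/
theorem bsdp_iff_regulatorValuation_of_lamMin_split
    (hWu : thm16_charIdeal_dvd_multiplicative_of_reducible) (hJs : thm61_splitMultiplicative)
    (hGZK : rank_eq_analyticRank_of_analyticRank_le_one) (hpar : nonempty_modularParametrizationData)
    (W : WeierstrassCurve ℚ) [W.IsElliptic] [W.IsGloballyMinimal] (p : ℕ) [Fact p.Prime]
    (hp2 : p ≠ 2) (hred : ¬ W.HasIrreducibleModPGaloisRep p) (hr : W.analyticRank = 1)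
    (Dq : TateParameterData W p) {Dh : PAdicHeightData W p} (hDh : IsSplitMultCanonical Dh Dq)
    (hμ0 : AnalyticMuLE W p 0) (hlam : AnalyticLambdaEq W p 2) {s : ℚ} (hs : shaAn W = (s : ℂ)) :
    BSDp W p ↔
      (padicRegulator Dh).valuation = 2 + 2 * (padicValNat p W.torsionOrder : ℤ) -
        (LInvariant Dq).valuation - padicValNat p W.tamagawaProduct - padicValRat p s := by
  obtain ⟨-, hid⟩ := schneider_and_shaIdentity_of_lamMin_split hWu hJs hGZK hpar W p hp2 hred hr Dq
    hDh hμ0 hlam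
  obtain ⟨hrank, hfinsha⟩ := hGZK W hr.le
  haveI : Finite W.sha := hfinsha
  have hfin : Finite (AddCommGroup.primaryComponent W.sha p) := inferInstance
  rw [bsdp_iff_padicValRat_eq_of_shaAn_eq W p hrank hfin hs]
  constructor <;> intro h <;> linarith

/-- **NON-SPLIT `p`, λ-minimal X2c pair: `BSD(E,p) ⟺ ord_p Reg_p(E,Dh) = 1 + 2·ord_p #tors −
ord_p ∏c_ℓ − ord_p #Ш_an`.** [cite: SteinWuthrich2013, Thm. 6.1 (p. 20) and §4.2]
[cite: Wuthrich2014, Thm. 16] [cite: Miller2011LMS, Def. 1.1] -/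
theorem bsdp_iff_regulatorValuation_of_lamMin_nonsplit
    (hWu : thm16_charIdeal_dvd_multiplicative_of_reducible) (hJn : thm61_nonsplitMultiplicative)
    (hGZK : rank_eq_analyticRank_of_analyticRank_le_one) (hpar : nonempty_modularParametrizationData)
    (W : WeierstrassCurve ℚ) [W.IsElliptic] [W.IsGloballyMinimal] (p : ℕ) [Fact p.Prime]
    (hp2 : p ≠ 2) (hmult : W.HasMultiplicativeReductionAtPrime p)
    (hns : ¬ W.HasSplitMultiplicativeReductionAtPrime p)
    (hred : ¬ W.HasIrreducibleModPGaloisRep p) (hr : W.analyticRank = 1)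
    {q : ℚ_[p]} (hq0 : q ≠ 0) (hq1 : ‖q‖ < 1) (hqj : tateJ q = (W.j : ℚ_[p]))
    {Dh : PAdicHeightData W p} (hDh : IsMultCanonical Dh q)
    (hμ0 : AnalyticMuLE W p 0) (hlam : AnalyticLambdaEq W p 1) {s : ℚ} (hs : shaAn W = (s : ℂ)) :
    BSDp W p ↔
      (padicRegulator Dh).valuation = 1 + 2 * (padicValNat p W.torsionOrder : ℤ) -
        padicValNat p W.tamagawaProduct - padicValRat p s := by
  obtain ⟨-, hid⟩ := schneider_and_shaIdentity_of_lamMin_nonsplit hWu hJn hGZK hpar W p hp2 hmult hns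
    hred hr hq0 hq1 hqj hDh hμ0 hlam
  obtain ⟨hrank, hfinsha⟩ := hGZK W hr.le
  haveI : Finite W.sha := hfinsha
  have hfin : Finite (AddCommGroup.primaryComponent W.sha p) := inferInstance
  rw [bsdp_iff_padicValRat_eq_of_shaAn_eq W p hrank hfin hs]
  constructor <;> intro h <;> linarith

/-- **The certificate direction, split `p`** (for booking): `(μ_an, λ_an) = (0, 2)` and ONE computed
valuation `ord_p Reg_p(E,Dh) = 2 + 2·ord_p #tors − ord_p 𝓛_p − ord_p ∏c_ℓ − ord_p #Ш_an` ⇒ `BSD(E,p)`.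
Lever L3 (`Typed.X2.bsdp_of_thm16mult_split_of_canonical_certificate`) with `hordL`/`hcert` replaced
by the λ-minimality bits; no hypothesis `p ∤ #Ш_an`. Per pair; X2c stays CONSTRUCTION-SHAPED.
[cite: SteinWuthrich2013, Thm. 6.1 (p. 20) and §4.2] [cite: Wuthrich2014, Thm. 16] [cite: Miller2011LMS, Def. 1.1] -/
theorem bsdp_of_lamMin_of_regulatorValuation_split
    (hWu : thm16_charIdeal_dvd_multiplicative_of_reducible) (hJs : thm61_splitMultiplicative)
    (hGZK : rank_eq_analyticRank_of_analyticRank_le_one) (hpar : nonempty_modularParametrizationData)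
    (W : WeierstrassCurve ℚ) [W.IsElliptic] [W.IsGloballyMinimal] (p : ℕ) [Fact p.Prime]
    (hp2 : p ≠ 2) (hred : ¬ W.HasIrreducibleModPGaloisRep p) (hr : W.analyticRank = 1)
    (Dq : TateParameterData W p) {Dh : PAdicHeightData W p} (hDh : IsSplitMultCanonical Dh Dq)
    (hμ0 : AnalyticMuLE W p 0) (hlam : AnalyticLambdaEq W p 2) {s : ℚ} (hs : shaAn W = (s : ℂ))
    (hReg : (padicRegulator Dh).valuation = 2 + 2 * (padicValNat p W.torsionOrder : ℤ) -
        (LInvariant Dq).valuation - padicValNat p W.tamagawaProduct - padicValRat p s) :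
    BSDp W p :=
  (bsdp_iff_regulatorValuation_of_lamMin_split hWu hJs hGZK hpar W p hp2 hred hr Dq hDh hμ0 hlam
    hs).mpr hReg

/-- **The certificate direction, non-split `p`**: `(μ_an, λ_an) = (0, 1)` and
`ord_p Reg_p(E,Dh) = 1 + 2·ord_p #tors − ord_p ∏c_ℓ − ord_p #Ш_an` ⇒ `BSD(E,p)`. Per pair.
[cite: SteinWuthrich2013, Thm. 6.1 (p. 20) and §4.2] [cite: Wuthrich2014, Thm. 16] [cite: Miller2011LMS, Def. 1.1] -/
theorem bsdp_of_lamMin_of_regulatorValuation_nonsplit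
    (hWu : thm16_charIdeal_dvd_multiplicative_of_reducible) (hJn : thm61_nonsplitMultiplicative)
    (hGZK : rank_eq_analyticRank_of_analyticRank_le_one) (hpar : nonempty_modularParametrizationData)
    (W : WeierstrassCurve ℚ) [W.IsElliptic] [W.IsGloballyMinimal] (p : ℕ) [Fact p.Prime]
    (hp2 : p ≠ 2) (hmult : W.HasMultiplicativeReductionAtPrime p)
    (hns : ¬ W.HasSplitMultiplicativeReductionAtPrime p)
    (hred : ¬ W.HasIrreducibleModPGaloisRep p) (hr : W.analyticRank = 1)
    {q : ℚ_[p]} (hq0 : q ≠ 0) (hq1 : ‖q‖ < 1) (hqj : tateJ q = (W.j : ℚ_[p]))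
    {Dh : PAdicHeightData W p} (hDh : IsMultCanonical Dh q)
    (hμ0 : AnalyticMuLE W p 0) (hlam : AnalyticLambdaEq W p 1) {s : ℚ} (hs : shaAn W = (s : ℂ))
    (hReg : (padicRegulator Dh).valuation = 1 + 2 * (padicValNat p W.torsionOrder : ℤ) -
        padicValNat p W.tamagawaProduct - padicValRat p s) :
    BSDp W p :=
  (bsdp_iff_regulatorValuation_of_lamMin_nonsplit hWu hJn hGZK hpar W p hp2 hmult hns hred hr hq0 hq1
    hqj hDh hμ0 hlam hs).mpr hReg

/-- **Sub-cell form (for the Partition binder): on `CellC W p`, `BSD(E,p)` from `(μ_an, λ_an) = (0, 1+e)`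
and the predicted valuation of THE §4.2 regulator** — split and non-split clauses as guarded
hypotheses (`hlamS`/`hRegS` resp. `hlamN`/`hRegN`), the height datum quantified universally under its
pinning predicate (it is unique). Per pair; X2c stays CONSTRUCTION-SHAPED.
[cite: SteinWuthrich2013, Thm. 6.1 (p. 20) and §4.2] [cite: Wuthrich2014, Thm. 16] [cite: Miller2011LMS, Def. 1.1] -/
theorem cellC_bsdp_of_lamMin_of_regulatorValuation
    (hWu : thm16_charIdeal_dvd_multiplicative_of_reducible)
    (hJs : thm61_splitMultiplicative) (hJn : thm61_nonsplitMultiplicative)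
    (hHs : exists_isSplitMultCanonical) (hHn : exists_isMultCanonical)
    (hGZK : rank_eq_analyticRank_of_analyticRank_le_one) (hpar : nonempty_modularParametrizationData)
    (W : WeierstrassCurve ℚ) [W.IsElliptic] [W.IsGloballyMinimal] (p : ℕ) [Fact p.Prime]
    (hc : CellC W p) (hμ0 : AnalyticMuLE W p 0) {s : ℚ} (hs : shaAn W = (s : ℂ))
    (hlamS : W.HasSplitMultiplicativeReductionAtPrime p → AnalyticLambdaEq W p 2)
    (hRegS : ∀ (Dq : TateParameterData W p) (Dh : PAdicHeightData W p), IsSplitMultCanonical Dh Dq →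
      (padicRegulator Dh).valuation = 2 + 2 * (padicValNat p W.torsionOrder : ℤ) -
        (LInvariant Dq).valuation - padicValNat p W.tamagawaProduct - padicValRat p s)
    (hlamN : ¬ W.HasSplitMultiplicativeReductionAtPrime p → AnalyticLambdaEq W p 1)
    (hRegN : ¬ W.HasSplitMultiplicativeReductionAtPrime p →
      ∀ (q : ℚ_[p]) (Dh : PAdicHeightData W p), q ≠ 0 → ‖q‖ < 1 → tateJ q = (W.j : ℚ_[p]) →
        IsMultCanonical Dh q →
      (padicRegulator Dh).valuation = 1 + 2 * (padicValNat p W.torsionOrder : ℤ) -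
        padicValNat p W.tamagawaProduct - padicValRat p s) :
    BSDp W p := by
  obtain ⟨hr, hp2, hred, hmult⟩ := hc
  by_cases hsplit : W.HasSplitMultiplicativeReductionAtPrime p
  · obtain ⟨Dq⟩ := (nonempty_tateParameterData_iff_holds (W := W) (p := p)).mpr hsplit
    obtain ⟨Dh, hDh⟩ := hHs W p hp2 Dq
    exact bsdp_of_lamMin_of_regulatorValuation_split hWu hJs hGZK hpar W p hp2 hred hr Dq hDh hμ0
      (hlamS hsplit) hs (hRegS Dq Dh hDh)
  · obtain ⟨q, ⟨hq0, hq1, hqj⟩, -⟩ := existsUnique_tateJ_eq_of_one_lt_norm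
      (one_lt_norm_j_of_hasMultiplicativeReductionAtPrime (W := W) (p := p) hmult)
    obtain ⟨Dh, hDh⟩ := hHn W p hp2 hmult hsplit q hq0 hq1 hqj
    exact bsdp_of_lamMin_of_regulatorValuation_nonsplit hWu hJn hGZK hpar W p hp2 hmult hsplit hred hr
      hq0 hq1 hqj hDh hμ0 (hlamN hsplit) hs (hRegN hsplit q Dh hq0 hq1 hqj hDh)

end BSDp

end Summit.BirchSwinnertonDyer.Rank1Residual.X2

end
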